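import Mathlib
import Summits.ResolutionOfSingularities.ResolutionOfSingularities.Theorems.HomologicalConductorPersistenceCyclicTransfer
import HarnessLib

/-!
# Crux `Persistence` (stmt-16484) / rung S-2 `PersistenceSurface` (stmt-19970) — cyclic transfer, part 1:
# FAMILIES of equivariant free factorisations restrict to the invariants (chain W4.4b, seat res-L1-w44b-stub-4 gen 4)

[OURS · L1 w44b · Σ6 / C4 class] Nothing here is a statement of the manuscript under review (Hironaka 2017);
AI-written, weaker than expert review.  Bookkeeping half of the general `μ_d` transfer
(`…PersistenceCyclicTransferGeneral`, part 2), generalising the two- and three-summand cores of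
`…PersistenceInvolutionTransfer` (p510111) / `…PersistenceCyclicTransfer` (p515107).

SETTING. `U → V` commutative rings, `σ : V →ₐ[U] V` whose fixed ring is the (injective) image of `U`; `τ : M →+ M`
additive on a `V`-module `M`, `j : N ↪ M` a `U`-linear injection onto the `τ`-fixed vectors.

RESULTS.
* `exists_comp_eq_sum_comp` — a `Fin n`-family of free factorisation summands `∑_k β_k ∘ α_k` is one composite.
* `exists_restrict_of_equivariant` — ONE equivariant pair (`F (τ m) = σ ∘ F m`, `τ (G x) = G (σ ∘ x)`) restricts
  to `U`-linear maps through `Uˢ = (Vˢ)^σ`.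
* `exists_comp_eq_smul_id_fixed_of_equivariant_family` — CORE: a finite family of equivariant pairs with
  `∑_k Q_k (P_k m) = w • m`, `algebraMap u = w`, gives a free `U`-factorisation of `u • id_N`.
* small lemmas used by part 2: `sum_range_succ_shift` (cyclic shift of a periodic sum),
  `sum_pow_mul_eq_zero_of_isPrimitiveRoot` (character orthogonality for a primitive root of unity in a domain),
  `succ_dvd_add_mul_iff` (`(e+1) ∣ i' + e i ⟺ i = i'` for `i, i' ≤ e`), `iterate_map_smul_semilinear`,
  `iterate_add_mul_period`, `pow_apply_eq_pow_mul`.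

References: Iyengar–Takahashi, IMRN 2016, arXiv:1404.1476, Remark 2.13 (stable annihilation)
[`IyengarTakahashi2014`]; restriction to invariants is folklore (Reynolds).
-/

-- single-problem summit: the doubled namespace component `ResolutionOfSingularities` is forced
set_option linter.dupNamespace false

noncomputable section

open CategoryTheory Literature.RingTheory.CohomologyAnnihilator
open Summit.ResolutionOfSingularities.ResolutionOfSingularities.Theorems.NoZeno.SandwichCluster
open Summit.ResolutionOfSingularities.ResolutionOfSingularities.Theorems.HomologicalConductor.PersistenceSurfaceHullCover
open Summit.ResolutionOfSingularities.ResolutionOfSingularities.Theorems.HomologicalConductor.PersistenceInvolutionTransfer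
open Summit.ResolutionOfSingularities.ResolutionOfSingularities.Theorems.HomologicalConductor.PersistenceCyclicTransfer

universe u

namespace Summit.ResolutionOfSingularities.ResolutionOfSingularities.Theorems.HomologicalConductor.PersistenceCyclicTransferFamily

variable {U V : Type u} [CommRing U] [CommRing V] [Algebra U V]
variable {M : Type u} [AddCommGroup M] [Module V M] [Module U M] [IsScalarTower U V M]
variable {N : Type u} [AddCommGroup N] [Module U N]

/-! ## Bookkeeping: finite families of free factorisation summands, periodic sums, roots of unity -/

/-- A finite family of free factorisation summands `∑_j β_j ∘ α_j` (all through `Fin s → C`) is ONE composite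
`β ∘ α` through some `Fin t → C` (iterate `exists_comp_eq_comp_add_comp`). [folklore] -/
theorem exists_comp_eq_sum_comp {C : Type u} [CommRing C] {X : Type u} [AddCommGroup X] [Module C X] {s : ℕ}
    (n : ℕ) (α : Fin n → (X →ₗ[C] (Fin s → C))) (β : Fin n → ((Fin s → C) →ₗ[C] X)) :
    ∃ (t : ℕ) (a : X →ₗ[C] (Fin t → C)) (b : (Fin t → C) →ₗ[C] X), b ∘ₗ a = ∑ j, β j ∘ₗ α j := by
  induction n with
  | zero => exact ⟨0, 0, 0, by simp⟩
  | succ n ih =>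
    obtain ⟨t, a, b, hab⟩ := ih (fun j => α (Fin.castSucc j)) (fun j => β (Fin.castSucc j))
    obtain ⟨a', b', h'⟩ := exists_comp_eq_comp_add_comp a b (α (Fin.last n)) (β (Fin.last n))
    refine ⟨_, a', b', ?_⟩
    rw [h', hab, Fin.sum_univ_castSucc]

/-- Cyclic shift of a periodic sum: `ψ d = ψ 0 ⟹ ∑_{i<d} ψ (i+1) = ∑_{i<d} ψ i`. [folklore] -/
theorem sum_range_succ_shift {X : Type*} [AddCommMonoid X] [IsCancelAdd X] (d : ℕ) (ψ : ℕ → X)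
    (hψ : ψ d = ψ 0) : ∑ i ∈ Finset.range d, ψ (i + 1) = ∑ i ∈ Finset.range d, ψ i := by
  have h1 : ∑ i ∈ Finset.range (d + 1), ψ i = (∑ i ∈ Finset.range d, ψ (i + 1)) + ψ 0 :=
    Finset.sum_range_succ' ψ d
  have h2 : ∑ i ∈ Finset.range (d + 1), ψ i = (∑ i ∈ Finset.range d, ψ i) + ψ d :=
    Finset.sum_range_succ ψ d
  rw [hψ] at h2
  exact add_right_cancel (h1.symm.trans h2)

/-- In a domain, a primitive `d`-th root of unity satisfies character orthogonality:
`d ∤ m ⟹ ∑_{i<d} ω^{m i} = 0` (geometric sum of the root of unity `ω^m ≠ 1`). [folklore] -/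
theorem sum_pow_mul_eq_zero_of_isPrimitiveRoot {R : Type*} [CommRing R] [IsDomain R] {ω : R} {d : ℕ}
    (hω : IsPrimitiveRoot ω d) (m : ℕ) (hm : ¬ d ∣ m) : ∑ i ∈ Finset.range d, ω ^ (m * i) = 0 := by
  have hne : ω ^ m - 1 ≠ 0 := by
    intro h
    exact hm ((hω.pow_eq_one_iff_dvd m).mp (sub_eq_zero.mp h))
  have hgeom : (∑ i ∈ Finset.range d, (ω ^ m) ^ i) * (ω ^ m - 1) = (ω ^ m) ^ d - 1 := geom_sum_mul _ _
  have hd : (ω ^ m) ^ d = 1 := by rw [← pow_mul, mul_comm, pow_mul, hω.pow_eq_one, one_pow]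
  rw [hd, sub_self] at hgeom
  have h0 : ∑ i ∈ Finset.range d, (ω ^ m) ^ i = 0 := (mul_eq_zero.mp hgeom).resolve_right hne
  simpa [← pow_mul] using h0

/-- The residue computation behind orthogonality of the chosen pairs: for `i, i' ≤ e`,
`(e+1) ∣ i' + e·i ⟺ i = i'` (`e ≡ -1`). [folklore] -/
theorem succ_dvd_add_mul_iff {e i i' : ℕ} (hi : i ≤ e) (hi' : i' ≤ e) : (e + 1) ∣ i' + e * i ↔ i = i' := by
  haveI : NeZero (e + 1) := ⟨Nat.succ_ne_zero e⟩
  rw [← ZMod.natCast_eq_zero_iff]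
  have he : ((e : ℕ) : ZMod (e + 1)) = -1 := by
    have h : ((e + 1 : ℕ) : ZMod (e + 1)) = 0 := ZMod.natCast_self (e + 1)
    rw [Nat.cast_add, Nat.cast_one] at h
    exact eq_neg_of_add_eq_zero_left h
  rw [Nat.cast_add, Nat.cast_mul, he, neg_one_mul, ← sub_eq_add_neg, sub_eq_zero,
    ZMod.natCast_eq_natCast_iff', Nat.mod_eq_of_lt (Nat.lt_succ_of_le hi'),
    Nat.mod_eq_of_lt (Nat.lt_succ_of_le hi)]
  exact eq_comm

/-! ## Restriction of equivariant pairs to the invariants -/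

/-- **Restriction of ONE equivariant pair**: `V`-linear `F : M → Vˢ`, `G : Vˢ → M` with `F (τ m) = σ ∘ F m` and
`τ (G x) = G (σ ∘ x)` restrict to `U`-linear `f : N → Uˢ`, `g : Uˢ → N` with `j ∘ g ∘ f = G ∘ F ∘ j`
(`(Vˢ)^σ = Uˢ`; extracted from the proof of `exists_comp_eq_smul_id_fixed_of_equivariant₃`). [folklore] -/
theorem exists_restrict_of_equivariant (σ : V →ₐ[U] V)
    (hfix : ∀ v : V, σ v = v → ∃ u : U, algebraMap U V u = v) (hinj : Function.Injective (algebraMap U V))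
    (τ : M →+ M) (j : N →ₗ[U] M) (hjinj : Function.Injective j) (hjτ : ∀ n, τ (j n) = j n)
    (hjsurj : ∀ m, τ m = m → ∃ n, j n = m) {s : ℕ} (F : M →ₗ[V] (Fin s → V)) (G : (Fin s → V) →ₗ[V] M)
    (hF : ∀ m i, F (τ m) i = σ (F m i)) (hG : ∀ x, τ (G x) = G (fun i => σ (x i))) :
    ∃ (f : N →ₗ[U] (Fin s → U)) (g : (Fin s → U) →ₗ[U] N), ∀ n, j (g (f n)) = G (F (j n)) := by
  classical
  choose φ hφ using hfix
  choose ρ hρ using hjsurj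
  have hGfix : ∀ x : Fin s → U, τ (G (fun i => algebraMap U V (x i))) = G (fun i => algebraMap U V (x i)) := by
    intro x
    rw [hG]
    simp only [AlgHom.commutes]
  have hι : ∀ (x y : Fin s → U), (fun i => algebraMap U V ((x + y) i)) =
      (fun i => algebraMap U V (x i)) + (fun i => algebraMap U V (y i)) := fun x y => by
    funext i; simp
  have hιs : ∀ (c : U) (x : Fin s → U), (fun i => algebraMap U V ((c • x) i)) =
      algebraMap U V c • (fun i => algebraMap U V (x i)) := fun c x => by
    funext i; simp
  have hFfix : ∀ n i, σ (F (j n) i) = F (j n) i := fun n i => by rw [← hF, hjτ]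
  let f : N →ₗ[U] (Fin s → U) :=
    { toFun := fun n i => φ (F (j n) i) (hFfix n i)
      map_add' := fun n n' => by
        funext i
        apply hinj
        simp only [Pi.add_apply, map_add, hφ]
      map_smul' := fun c n => by
        funext i
        apply hinj
        simp only [Pi.smul_apply, smul_eq_mul, map_mul, RingHom.id_apply, hφ, LinearMap.map_smul_of_tower]
        exact Algebra.smul_def c _ }
  let g : (Fin s → U) →ₗ[U] N :=
    { toFun := fun x => ρ (G (fun i => algebraMap U V (x i))) (hGfix x)
      map_add' := fun x y => by
        apply hjinj
        rw [map_add, hρ, hρ, hρ, hι, map_add]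
      map_smul' := fun c x => by
        apply hjinj
        rw [LinearMap.map_smul_of_tower, hρ, hρ, RingHom.id_apply, hιs, map_smul, algebraMap_smul] }
  refine ⟨f, g, fun n => ?_⟩
  have hf : (fun i => algebraMap U V (f n i)) = F (j n) := by funext i; exact hφ _ _
  change j (ρ _ _) = _
  rw [hρ, hf]

/-- **Core restriction lemma, finite family**: equivariant pairs `(P_k, Q_k)_{k < n}` with
`∑_k Q_k (P_k m) = w • m` and `algebraMap u = w` give a free `U`-factorisation of `u • id_N` on the invariants.
[folklore] -/
theorem exists_comp_eq_smul_id_fixed_of_equivariant_family (σ : V →ₐ[U] V)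
    (hfix : ∀ v : V, σ v = v → ∃ u : U, algebraMap U V u = v) (hinj : Function.Injective (algebraMap U V))
    (τ : M →+ M) (j : N →ₗ[U] M) (hjinj : Function.Injective j) (hjτ : ∀ n, τ (j n) = j n)
    (hjsurj : ∀ m, τ m = m → ∃ n, j n = m) {s n : ℕ} (P : Fin n → (M →ₗ[V] (Fin s → V)))
    (Q : Fin n → ((Fin s → V) →ₗ[V] M)) (hP : ∀ k m i, P k (τ m) i = σ (P k m i))
    (hQ : ∀ k x, τ (Q k x) = Q k (fun i => σ (x i))) {w : V} (hsum : ∀ m, ∑ k, Q k (P k m) = w • m)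
    (u : U) (hu : algebraMap U V u = w) :
    ∃ (t : ℕ) (f' : N →ₗ[U] (Fin t → U)) (g' : (Fin t → U) →ₗ[U] N), g' ∘ₗ f' = u • LinearMap.id := by
  choose p q hpq using fun k =>
    exists_restrict_of_equivariant σ hfix hinj τ j hjinj hjτ hjsurj (P k) (Q k) (hP k) (hQ k)
  have hsumU : ∑ k, q k ∘ₗ p k = u • LinearMap.id := by
    apply LinearMap.ext
    intro x
    apply hjinj
    simp only [LinearMap.coe_sum, Finset.sum_apply, LinearMap.comp_apply, map_sum, hpq, hsum,
      LinearMap.smul_apply, LinearMap.id_apply, LinearMap.map_smul_of_tower, ← hu, algebraMap_smul]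
  obtain ⟨t, a, b, hab⟩ := exists_comp_eq_sum_comp n p q
  exact ⟨t, a, b, hab.trans hsumU⟩

/-! ## Iterates of `σ` and `τ` -/

omit [Module U M] [IsScalarTower U V M] in
/-- Iterates of a `σ`-semilinear map are `σⁿ`-semilinear. [folklore] -/
theorem iterate_map_smul_semilinear (σ : V →ₐ[U] V) (τ : M →+ M)
    (hτ : ∀ (v : V) (m : M), τ (v • m) = σ v • τ m) (n : ℕ) (v : V) (m : M) :
    (⇑τ)^[n] (v • m) = (σ ^ n) v • (⇑τ)^[n] m := by
  induction n generalizing v m with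
  | zero => simp
  | succ n ih =>
    rw [Function.iterate_succ_apply, Function.iterate_succ_apply, hτ, ih, pow_succ, AlgHom.mul_apply]

/-- A map of period `d` has period every multiple of `d`: `γ^[d] = id ⟹ γ^[n + k d] = γ^[n]`. [folklore] -/
theorem iterate_add_mul_period {X : Type*} (γ : X → X) {d : ℕ} (hγ : ∀ x, γ^[d] x = x) (n k : ℕ) (x : X) :
    γ^[n + k * d] x = γ^[n] x := by
  rw [Function.iterate_add_apply, mul_comm, Function.iterate_mul, Function.iterate_fixed (hγ x)]

/-- Iterating the character relation: `σ c = η c` with `η = algebraMap ω` ⟹ `σⁿ c = ηⁿ c`. [folklore] -/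
theorem pow_apply_eq_pow_mul (σ : V →ₐ[U] V) (ω : U) {c : V} (hc : σ c = algebraMap U V ω * c) (n : ℕ) :
    (σ ^ n) c = algebraMap U V ω ^ n * c := by
  induction n with
  | zero => simp
  | succ n ih =>
    rw [pow_succ, AlgHom.mul_apply, hc, map_mul, ih, AlgHom.commutes, pow_succ]
    ring

end Summit.ResolutionOfSingularities.ResolutionOfSingularities.Theorems.HomologicalConductor.PersistenceCyclicTransferFamily

end
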